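import Summits.AtomisticToContinuum.BoseEinsteinCondensation.Theorems.BECInfDivCoherenceLevyNegativeMomentNearFieldCoherence
import Summits.AtomisticToContinuum.BoseEinsteinCondensation.Theses.BECInfDivCoherence
import Literature.MathematicalPhysics.QuantumManyBody.BoseGasDirichletWall
import HarnessLib

/-!
# Crux `LevyNegativeMoment` (stmt-AtomisticToContinuum-9115), line `registered`:
# the free gas satisfies the crux and both registered stubs, exactly as typed

Support file (`--supports stmt-AtomisticToContinuum-9115`; lead c4).  A kernel-checked NON-VACUITY and
well-formedness certificate for the crux and for both open registered stubs of line `registered`: the ideal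
gas `v ≡ 0` satisfies each of them VERBATIM as typed (with `C = 1`, every `η > 0`, every density, all
`N ≥ 1`) — so the quantifier order (`C` before `ρ`, `δ` after `N`), the grid junk conventions
(`m = ⌊L/η⌋₊`, `L/m`, `latticeVec`), the unguarded `Real.log` and the centred wave number `|k_q|` hide no
vacuity or falsity in the only exactly solvable case (four leads had asserted this informally).

Mechanism (no spectral theory): `E₀^per(0) = 0` (`periodicGroundStateEnergy_zero_eq_zero`), so a
`δ`-near-minimiser has total kinetic energy `≤ δ`; the kinetic bound of the companion file
(`one_sub_coh_le_kinetic`: `1 - G(i, r) ≤ 2‖r‖² δ/N`) with `δ = Nε/(6L²)` makes `1 - G ≤ ε` on the whole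
cell, hence `|log G| ≤ 2ε` at every grid node (`free_nearMinimiser_log`); choosing
`ε = 1/(2(m³+1)(L+1))` AFTER `N` (allowed: `δ` is chosen after `N`) beats the `m³` Lévy weights, the
factor `L/2π` of the smallest wave number and the `m³` grid terms (`abs_levyWeight_le`,
`sum_max_div_waveNumber_le`, `sum_abs_mul_weight_le`).

* `levyNegativeMoment_free` — the body of the crux at `v = 0`;
* `schoenbergDefect_free`, `logClusterL1_free` — the registered stubs `stub_schoenbergDefect`,
  `stub_logClusterL1` at `v = 0`;
* `levyNegativeMoment_of_ne_zero` — the crux BY NAME follows from its body restricted to `v ≠ 0`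
  (certifying that the free-case statement is literally the route decl's instance).

Nothing here bears on interacting `v`: there the kinetic energy per particle of a near-minimiser is
`≍ 4πaρ`, the same bound controls `G` only out to the healing length (companion file), and the rest is
the infrared content certified to be ≥ the sub-problem target (`…TargetStrengthGeneral.lean`).
-/

noncomputable section

namespace Summit.AtomisticToContinuum.BoseEinsteinCondensation.Theorems.CoherenceNearField

open MeasureTheory Filter Literature.MathematicalPhysics.QuantumManyBody
  Literature.MathematicalPhysics.QuantumManyBody.BoseGas InfDivGlue
open scoped ENNReal NNReal ComplexConjugate

variable {N : ℕ} {L : ℝ}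

/-! ### The free gas in a fixed box: near-minimisers are uniformly coherent -/

/-- **Free gas, fixed box**: for `v ≡ 0`, `L > 0`, `N ≥ 1` and every `ε > 0` there is `δ > 0` (namely
`δ = Nε/(6L²)`) such that every `δ`-near-minimiser of the free periodic energy (`E₀^per = 0`, so: every
periodic state with kinetic energy `≤ δ`) has `1 - G_Ψ(i, r) ≤ ε` for all particles `i` and all `r` with
`‖r‖² ≤ 3L²` (the diameter of the cell). [folklore] -/
theorem free_nearMinimiser_coherence (hL : 0 < L) (hN : 0 < N) {ε : ℝ} (hε : 0 < ε) :
    ∃ δ : ℝ≥0∞, 0 < δ ∧ ∀ Ψ : PeriodicTrialState N L,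
      periodicEnergy 0 Ψ ≤ periodicGroundStateEnergy 0 N L + δ →
        ∀ (i : Fin N) (r : Space), ‖r‖ ^ 2 ≤ 3 * L ^ 2 →
          1 - (∫ X in cellN N L, conj (Ψ.ψ (Function.update X i (X i + r))) * Ψ.ψ X).re ≤ ε := by
  refine ⟨ENNReal.ofReal (N * ε / (6 * L ^ 2)), ENNReal.ofReal_pos.2 (by positivity),
    fun Ψ hΨ i r hr => ?_⟩
  have hkin : (∫⁻ X in cellN N L, kineticDensity Ψ.ψ X) ≤ ENNReal.ofReal (N * ε / (6 * L ^ 2)) := by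
    calc (∫⁻ X in cellN N L, kineticDensity Ψ.ψ X) ≤ periodicEnergy 0 Ψ :=
          lintegral_kinetic_le_periodicEnergy 0 Ψ
      _ ≤ periodicGroundStateEnergy 0 N L + ENNReal.ofReal (N * ε / (6 * L ^ 2)) := hΨ
      _ = ENNReal.ofReal (N * ε / (6 * L ^ 2)) := by
          rw [periodicGroundStateEnergy_zero_eq_zero N hL, zero_add]
  have key := one_sub_coh_le_kinetic hL Ψ hkin ENNReal.ofReal_ne_top i r
  have hq : (ENNReal.ofReal (N * ε / (6 * L ^ 2)) / N).toReal = ε / (6 * L ^ 2) := by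
    rw [ENNReal.toReal_div, ENNReal.toReal_ofReal (by positivity), ENNReal.toReal_natCast]
    have hN' : (N : ℝ) ≠ 0 := Nat.cast_ne_zero.2 hN.ne'
    field_simp
  rw [hq] at key
  calc 1 - (∫ X in cellN N L, conj (Ψ.ψ (Function.update X i (X i + r))) * Ψ.ψ X).re
      ≤ 2 * ‖r‖ ^ 2 * (ε / (6 * L ^ 2)) := key
    _ ≤ 2 * (3 * L ^ 2) * (ε / (6 * L ^ 2)) := by gcongr
    _ = ε := by field_simp; ring

/-- **Free gas, fixed box, logarithmic form**: for `0 < ε ≤ 1/2`, with the same `δ`, every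
`δ`-near-minimiser has `G_Ψ(i, r) ≥ 1/2` and `|log G_Ψ(i, r)| ≤ 2ε` on `‖r‖² ≤ 3L²`. [folklore] -/
theorem free_nearMinimiser_log (hL : 0 < L) (hN : 0 < N) {ε : ℝ} (hε : 0 < ε) (hε2 : ε ≤ 1 / 2) :
    ∃ δ : ℝ≥0∞, 0 < δ ∧ ∀ Ψ : PeriodicTrialState N L,
      periodicEnergy 0 Ψ ≤ periodicGroundStateEnergy 0 N L + δ →
        ∀ (i : Fin N) (r : Space), ‖r‖ ^ 2 ≤ 3 * L ^ 2 →
          |Real.log ((∫ X in cellN N L, conj (Ψ.ψ (Function.update X i (X i + r))) * Ψ.ψ X).re)| ≤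
            2 * ε := by
  obtain ⟨δ, hδ, H⟩ := free_nearMinimiser_coherence hL hN hε
  refine ⟨δ, hδ, fun Ψ hΨ i r hr => ?_⟩
  have h1 := H Ψ hΨ i r hr
  have h2 := coh_le_one hL Ψ i r
  calc |Real.log ((∫ X in cellN N L, conj (Ψ.ψ (Function.update X i (X i + r))) * Ψ.ψ X).re)|
      ≤ 2 * (1 - (∫ X in cellN N L, conj (Ψ.ψ (Function.update X i (X i + r))) * Ψ.ψ X).re) :=
        abs_log_le_two_mul_one_sub (by linarith) h2
    _ ≤ 2 * ε := by linarith

/-! ### Grid bookkeeping -/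

/-- The grid nodes `(L/m) j`, `j ∈ {0,…,m-1}³`, lie in the cell: `‖(L/m) j‖² ≤ 3L²`. [folklore] -/
theorem norm_sq_latticeVec_grid_le {m : ℕ} (hL : 0 ≤ L) (j : Fin 3 → Fin m) :
    ‖latticeVec (L / m) (fun k => ((j k : ℕ) : ℤ))‖ ^ 2 ≤ 3 * L ^ 2 := by
  rcases Nat.eq_zero_or_pos m with rfl | hm
  · exact (Fin.elim0 (j 0) : False).elim
  have hm' : (0 : ℝ) < m := Nat.cast_pos.2 hm
  have hcoord : ∀ k : Fin 3, (L / m * ((j k : ℕ) : ℝ)) ^ 2 ≤ L ^ 2 := by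
    intro k
    have hjk : ((j k : ℕ) : ℝ) ≤ m := by exact_mod_cast (j k).is_lt.le
    have h0 : 0 ≤ L / m * ((j k : ℕ) : ℝ) := by positivity
    have h1 : L / m * ((j k : ℕ) : ℝ) ≤ L := by
      calc L / m * ((j k : ℕ) : ℝ) ≤ L / m * m := by gcongr
        _ = L := by field_simp
    nlinarith
  have hns : ‖latticeVec (L / m) (fun k => ((j k : ℕ) : ℤ))‖ ^ 2 =
      ∑ k : Fin 3, (L / m * ((j k : ℕ) : ℝ)) ^ 2 := by
    rw [EuclideanSpace.norm_sq_eq]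
    refine Finset.sum_congr rfl fun k _ => ?_
    simp [latticeVec, abs_of_nonneg hL]
  rw [hns, Fin.sum_univ_three]
  linarith [hcoord 0, hcoord 1, hcoord 2]

/-- A uniform bound on the grid values bounds every discrete Lévy weight:
`|m⁻³ Σ_j F(j) cos θ_{qj}| ≤ B`. [folklore] -/
theorem abs_levyWeight_le {m : ℕ} {F : (Fin 3 → Fin m) → ℝ} {θ : (Fin 3 → Fin m) → (Fin 3 → Fin m) → ℝ}
    {B : ℝ} (hB : 0 ≤ B) (hF : ∀ j, |F j| ≤ B) (q : Fin 3 → Fin m) :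
    |(∑ j, F j * Real.cos (θ q j)) / (m : ℝ) ^ 3| ≤ B := by
  rcases Nat.eq_zero_or_pos m with rfl | hm
  · exact (Fin.elim0 (q 0) : False).elim
  have hm3 : (0 : ℝ) < (m : ℝ) ^ 3 := by positivity
  rw [abs_div, abs_of_pos hm3, div_le_iff₀ hm3]
  calc |∑ j, F j * Real.cos (θ q j)| ≤ ∑ j, |F j * Real.cos (θ q j)| := Finset.abs_sum_le_sum_abs _ _
    _ ≤ ∑ _j : Fin 3 → Fin m, B := by
        refine Finset.sum_le_sum fun j _ => ?_
        rw [abs_mul]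
        calc |F j| * |Real.cos (θ q j)| ≤ B * 1 :=
              mul_le_mul (hF j) (Real.abs_cos_le_one _) (abs_nonneg _) hB
          _ = B := mul_one B
    _ = B * (m : ℝ) ^ 3 := by
        rw [Finset.sum_const, Finset.card_univ, Fintype.card_fun, Fintype.card_fin, Fintype.card_fin,
          nsmul_eq_mul]
        push_cast
        ring

/-- Off `q ≡ 0` the centred wave number is at least one grid unit: `1 ≤ Σ_k min(q_k, m - q_k)²`. [folklore] -/
theorem one_le_sum_min_sq {m : ℕ} {q : Fin 3 → Fin m} (hq : ∃ k, (q k : ℕ) ≠ 0) :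
    (1 : ℝ) ≤ ∑ k, ((min (q k : ℕ) (m - (q k : ℕ)) : ℕ) : ℝ) ^ 2 := by
  obtain ⟨k, hk⟩ := hq
  have h1 : (1 : ℕ) ≤ min (q k : ℕ) (m - (q k : ℕ)) := by
    have := (q k).is_lt
    exact le_min (Nat.one_le_iff_ne_zero.2 hk) (by omega)
  have h1' : (1 : ℝ) ≤ ((min (q k : ℕ) (m - (q k : ℕ)) : ℕ) : ℝ) := by exact_mod_cast h1
  calc (1 : ℝ) ≤ ((min (q k : ℕ) (m - (q k : ℕ)) : ℕ) : ℝ) ^ 2 := by nlinarith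
    _ ≤ ∑ k, ((min (q k : ℕ) (m - (q k : ℕ)) : ℕ) : ℝ) ^ 2 :=
        Finset.single_le_sum (f := fun k => ((min (q k : ℕ) (m - (q k : ℕ)) : ℕ) : ℝ) ^ 2)
          (fun _ _ => sq_nonneg _) (Finset.mem_univ k)

/-- **The (−1)-moment of uniformly small weights**: if `|w_q| ≤ B` for all `q` then
`Σ_(q≢0) max(w_q, 0)/|k_q| ≤ m³ · BL/(2π)` (`|k_q| = (2π/L)·‖q̄‖ ≥ 2π/L` off zero). [folklore] -/
theorem sum_max_div_waveNumber_le {m : ℕ} {w : (Fin 3 → Fin m) → ℝ} {B : ℝ} (hL : 0 < L) (hB : 0 ≤ B)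
    (hw : ∀ q, |w q| ≤ B) :
    ∑ q : Fin 3 → Fin m with (∃ k, (q k : ℕ) ≠ 0), max (w q) 0 /
        (2 * Real.pi / L * Real.sqrt (∑ k, ((min (q k : ℕ) (m - (q k : ℕ)) : ℕ) : ℝ) ^ 2)) ≤
      (m : ℝ) ^ 3 * (B * L / (2 * Real.pi)) := by
  have hterm : ∀ q ∈ (Finset.univ : Finset (Fin 3 → Fin m)).filter (fun q => ∃ k, (q k : ℕ) ≠ 0),
      max (w q) 0 / (2 * Real.pi / L * Real.sqrt (∑ k, ((min (q k : ℕ) (m - (q k : ℕ)) : ℕ) : ℝ) ^ 2)) ≤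
        B * L / (2 * Real.pi) := by
    intro q hq
    have hq' : ∃ k, (q k : ℕ) ≠ 0 := (Finset.mem_filter.1 hq).2
    have hs : 1 ≤ Real.sqrt (∑ k, ((min (q k : ℕ) (m - (q k : ℕ)) : ℕ) : ℝ) ^ 2) := by
      rw [← Real.sqrt_one]
      exact Real.sqrt_le_sqrt (one_le_sum_min_sq hq')
    have hden : 2 * Real.pi / L ≤
        2 * Real.pi / L * Real.sqrt (∑ k, ((min (q k : ℕ) (m - (q k : ℕ)) : ℕ) : ℝ) ^ 2) := by
      calc 2 * Real.pi / L = 2 * Real.pi / L * 1 := (mul_one _).symm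
        _ ≤ _ := mul_le_mul_of_nonneg_left hs (by positivity)
    have hdenpos : 0 < 2 * Real.pi / L := by positivity
    have hmax : max (w q) 0 ≤ B := max_le ((le_abs_self _).trans (hw q)) hB
    calc max (w q) 0 / (2 * Real.pi / L * Real.sqrt (∑ k, ((min (q k : ℕ) (m - (q k : ℕ)) : ℕ) : ℝ) ^ 2))
        ≤ B / (2 * Real.pi / L * Real.sqrt (∑ k, ((min (q k : ℕ) (m - (q k : ℕ)) : ℕ) : ℝ) ^ 2)) :=
          div_le_div_of_nonneg_right hmax (hdenpos.le.trans hden)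
      _ ≤ B / (2 * Real.pi / L) := div_le_div_of_nonneg_left hB hdenpos hden
      _ = B * L / (2 * Real.pi) := by field_simp
  have hnonneg : ∀ q ∈ (Finset.univ : Finset (Fin 3 → Fin m)),
      q ∉ (Finset.univ : Finset (Fin 3 → Fin m)).filter (fun q => ∃ k, (q k : ℕ) ≠ 0) →
      0 ≤ max (w q) 0 / (2 * Real.pi / L * Real.sqrt (∑ k, ((min (q k : ℕ) (m - (q k : ℕ)) : ℕ) : ℝ) ^ 2)) :=
    fun q _ _ => div_nonneg (le_max_right _ _) (by positivity)
  calc ∑ q : Fin 3 → Fin m with (∃ k, (q k : ℕ) ≠ 0), max (w q) 0 /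
          (2 * Real.pi / L * Real.sqrt (∑ k, ((min (q k : ℕ) (m - (q k : ℕ)) : ℕ) : ℝ) ^ 2))
      ≤ ∑ q : Fin 3 → Fin m with (∃ k, (q k : ℕ) ≠ 0), B * L / (2 * Real.pi) := Finset.sum_le_sum hterm
    _ ≤ ∑ _q : Fin 3 → Fin m, B * L / (2 * Real.pi) :=
        Finset.sum_le_sum_of_subset_of_nonneg (Finset.filter_subset _ _)
          (fun _ _ _ => by positivity)
    _ = (m : ℝ) ^ 3 * (B * L / (2 * Real.pi)) := by
        rw [Finset.sum_const, Finset.card_univ, Fintype.card_fun, Fintype.card_fin, Fintype.card_fin,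
          nsmul_eq_mul]
        push_cast
        ring

/-- **The weighted ℓ¹ sum of uniformly small grid values**: if `|F_j| ≤ B` for all `j` then
`Σ_j |F_j - 0| · (L/m)/(1 + ‖j‖²_per) ≤ m³ · B L`. [folklore] -/
theorem sum_abs_mul_weight_le {m : ℕ} {F : (Fin 3 → Fin m) → ℝ} {B : ℝ} (hL : 0 ≤ L) (hB : 0 ≤ B)
    (hF : ∀ j, |F j| ≤ B) :
    ∑ j : Fin 3 → Fin m, |F j - 0| * ((L / m) / (1 + ∑ k, ((min (j k : ℕ) (m - (j k : ℕ)) : ℕ) : ℝ) ^ 2)) ≤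
      (m : ℝ) ^ 3 * (B * L) := by
  have hterm : ∀ j : Fin 3 → Fin m,
      |F j - 0| * ((L / m) / (1 + ∑ k, ((min (j k : ℕ) (m - (j k : ℕ)) : ℕ) : ℝ) ^ 2)) ≤ B * L := by
    intro j
    rw [sub_zero]
    have hw : (L / m) / (1 + ∑ k, ((min (j k : ℕ) (m - (j k : ℕ)) : ℕ) : ℝ) ^ 2) ≤ L := by
      have hS : (1 : ℝ) ≤ 1 + ∑ k, ((min (j k : ℕ) (m - (j k : ℕ)) : ℕ) : ℝ) ^ 2 :=
        le_add_of_nonneg_right (Finset.sum_nonneg fun _ _ => sq_nonneg _)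
      have hLm : L / m ≤ L := by
        rcases Nat.eq_zero_or_pos m with rfl | hm
        · simp [hL]
        · exact div_le_self hL (by exact_mod_cast hm)
      calc (L / m) / (1 + ∑ k, ((min (j k : ℕ) (m - (j k : ℕ)) : ℕ) : ℝ) ^ 2) ≤ L / m :=
            div_le_self (div_nonneg hL (Nat.cast_nonneg _)) hS
        _ ≤ L := hLm
    exact mul_le_mul (hF j) hw (by positivity) hB
  calc ∑ j : Fin 3 → Fin m, |F j - 0| * ((L / m) / (1 + ∑ k, ((min (j k : ℕ) (m - (j k : ℕ)) : ℕ) : ℝ) ^ 2))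
      ≤ ∑ _j : Fin 3 → Fin m, B * L := Finset.sum_le_sum fun j _ => hterm j
    _ = (m : ℝ) ^ 3 * (B * L) := by
        rw [Finset.sum_const, Finset.card_univ, Fintype.card_fun, Fintype.card_fin, Fintype.card_fin,
          nsmul_eq_mul]
        push_cast
        ring

/-! ### The free gas satisfies the crux and both registered stubs, exactly as typed -/

/-- The smallness parameter used below is at most `1/2`. [folklore] -/
theorem eps_le_half {A B : ℝ} (hA : 1 ≤ A) (hB : 1 ≤ B) : 1 / (2 * A * B) ≤ 1 / 2 :=
  one_div_le_one_div_of_le (by norm_num) (by nlinarith [mul_le_mul hA hB zero_le_one (by linarith)])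

/-- The final arithmetic: `m³ · (2ε) · L / d ≤ 1/d` for `ε = 1/(2(m³+1)(L+1))`. [folklore] -/
theorem cube_mul_eps_mul_le {M L d : ℝ} (hM : 0 ≤ M) (hL : 0 ≤ L) (hd : 0 < d) :
    M * (2 * (1 / (2 * (M + 1) * (L + 1))) * L / d) ≤ 1 / d := by
  have h1 : M * L ≤ (M + 1) * (L + 1) := by nlinarith
  have hpos : 0 < (M + 1) * (L + 1) := by positivity
  calc M * (2 * (1 / (2 * (M + 1) * (L + 1))) * L / d) = (M * L) / ((M + 1) * (L + 1)) / d := by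
        field_simp
    _ ≤ 1 / d := by
        gcongr
        rwa [div_le_one hpos]

/-- **The crux holds for the free gas** (`v ≡ 0`, with `C = 1` for every grid scale `η`, every density,
all `N ≥ 1`): verbatim the body of `LevyNegativeMoment` at `v = 0`.  With `δ` from
`free_nearMinimiser_log` at `ε = 1/(2(m³+1)(L+1))` every grid value has `|log G| ≤ 2ε`, so every discrete
Lévy weight has `|ν̃_q| ≤ 2ε` (`abs_levyWeight_le`) and `Σ_(q≢0) ν̃⁺_q/|k_q| ≤ m³ εL/π ≤ 1/(2π)`
(`sum_max_div_waveNumber_le`). [folklore] -/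
theorem levyNegativeMoment_free : ∀ η : ℝ, 0 < η → ∃ C : ℝ, ∃ ρ₀ : ℝ, 0 < ρ₀ ∧ ∀ ρ : ℝ, 0 < ρ → ρ < ρ₀ → ∀ᶠ N : ℕ in Filter.atTop, ∃ δ : ENNReal, 0 < δ ∧ ∀ Ψ : Literature.MathematicalPhysics.QuantumManyBody.BoseGas.PeriodicTrialState N (Literature.MathematicalPhysics.QuantumManyBody.BoseGas.sideLength ρ N), Literature.MathematicalPhysics.QuantumManyBody.BoseGas.periodicEnergy (0 : ℝ → ENNReal) Ψ ≤ Literature.MathematicalPhysics.QuantumManyBody.BoseGas.periodicGroundStateEnergy (0 : ℝ → ENNReal) N (Literature.MathematicalPhysics.QuantumManyBody.BoseGas.sideLength ρ N) + δ → ∀ i : Fin N, let L : ℝ := Literature.MathematicalPhysics.QuantumManyBody.BoseGas.sideLength ρ N; let m : ℕ := ⌊L / η⌋₊; let G : EuclideanSpace ℝ (Fin 3) → ℝ := fun r => (∫ X in Literature.MathematicalPhysics.QuantumManyBody.BoseGas.cellN N L, conj (Ψ.ψ (Function.update X i (X i + r))) * Ψ.ψ X).re; let ν : (Fin 3 → Fin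 m) → ℝ := fun q => (∑ j : Fin 3 → Fin m, Real.log (G (Literature.MathematicalPhysics.QuantumManyBody.BoseGas.latticeVec (L / m) (fun k => ((j k : ℕ) : ℤ)))) * Real.cos (2 * Real.pi * (∑ k, ((q k : ℕ) : ℝ) * ((j k : ℕ) : ℝ)) / m)) / (m : ℝ) ^ 3; (∑ q : Fin 3 → Fin m with (∃ k, (q k : ℕ) ≠ 0), max (ν q) 0 / (2 * Real.pi / L * Real.sqrt (∑ k, ((min (q k : ℕ) (m - (q k : ℕ)) : ℕ) : ℝ) ^ 2))) ≤ C := by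
  intro η hη
  refine ⟨1, 1, one_pos, fun ρ hρ _ => ?_⟩
  filter_upwards [eventually_gt_atTop 0] with N hN
  have hL : 0 < sideLength ρ N := by
    unfold sideLength
    exact Real.rpow_pos_of_pos (div_pos (Nat.cast_pos.2 hN) hρ) _
  set L : ℝ := sideLength ρ N with hLdef
  set m : ℕ := ⌊L / η⌋₊ with hmdef
  set ε : ℝ := 1 / (2 * ((m : ℝ) ^ 3 + 1) * (L + 1)) with hε
  have hεpos : 0 < ε := by positivity
  have hε2 : ε ≤ 1 / 2 := eps_le_half (by nlinarith [pow_nonneg (Nat.cast_nonneg m : (0 : ℝ) ≤ m) 3])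
    (by linarith)
  obtain ⟨δ, hδ, H⟩ := free_nearMinimiser_log hL hN hεpos hε2
  refine ⟨δ, hδ, fun Ψ hΨ i => ?_⟩
  dsimp only
  have hlog : ∀ j : Fin 3 → Fin m, |Real.log ((∫ X in cellN N L, conj (Ψ.ψ (Function.update X i
      (X i + latticeVec (L / m) (fun k => ((j k : ℕ) : ℤ))))) * Ψ.ψ X).re)| ≤ 2 * ε :=
    fun j => H Ψ hΨ i _ (norm_sq_latticeVec_grid_le hL.le j)
  have hν : ∀ q : Fin 3 → Fin m, |(∑ j : Fin 3 → Fin m, Real.log ((∫ X in cellN N L,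
      conj (Ψ.ψ (Function.update X i (X i + latticeVec (L / m) (fun k => ((j k : ℕ) : ℤ))))) * Ψ.ψ X).re) *
        Real.cos (2 * Real.pi * (∑ k, ((q k : ℕ) : ℝ) * ((j k : ℕ) : ℝ)) / m)) / (m : ℝ) ^ 3| ≤ 2 * ε :=
    fun q => abs_levyWeight_le (θ := fun q j => 2 * Real.pi * (∑ k, ((q k : ℕ) : ℝ) * ((j k : ℕ) : ℝ)) / m)
      (by positivity) hlog q
  calc _ ≤ (m : ℝ) ^ 3 * (2 * ε * L / (2 * Real.pi)) := sum_max_div_waveNumber_le hL (by positivity) hν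
    _ ≤ 1 / (2 * Real.pi) := cube_mul_eps_mul_le (by positivity) hL.le (by positivity)
    _ ≤ 1 := by
        rw [div_le_one (by positivity)]
        linarith [Real.pi_gt_three]

/-- **The registered stub `stub_schoenbergDefect` holds for the free gas** (`C = 1`): verbatim its
registered signature at `v = 0` (the same bookkeeping applied to `-ν̃`). [folklore] -/
theorem schoenbergDefect_free : ∀ η : ℝ, 0 < η → ∃ C : ℝ, ∃ ρ₀ : ℝ, 0 < ρ₀ ∧ ∀ ρ : ℝ, 0 < ρ → ρ < ρ₀ → ∀ᶠ N : ℕ in Filter.atTop, ∃ δ : ENNReal, 0 < δ ∧ ∀ Ψ : Literature.MathematicalPhysics.QuantumManyBody.BoseGas.PeriodicTrialState N (Literature.MathematicalPhysics.QuantumManyBody.BoseGas.sideLength ρ N), Literature.MathematicalPhysics.QuantumManyBody.BoseGas.periodicEnergy (0 : ℝ → ENNReal) Ψ ≤ Literature.MathematicalPhysics.QuantumManyBody.BoseGas.periodicGroundStateEnergy (0 : ℝ → ENNReal) N (Literature.MathematicalPhysics.QuantumManyBody.BoseGas.sideLength ρ N) + δ → ∀ i : Fin N, let L : ℝ := Literature.MathematicalPhysics.QuantumManyBody.BoseGas.sideLength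 ρ N; let m : ℕ := ⌊L / η⌋₊; let G : EuclideanSpace ℝ (Fin 3) → ℝ := fun r => (∫ X in Literature.MathematicalPhysics.QuantumManyBody.BoseGas.cellN N L, conj (Ψ.ψ (Function.update X i (X i + r))) * Ψ.ψ X).re; let ν : (Fin 3 → Fin m) → ℝ := fun q => (∑ j : Fin 3 → Fin m, Real.log (G (Literature.MathematicalPhysics.QuantumManyBody.BoseGas.latticeVec (L / m) (fun k => ((j k : ℕ) : ℤ)))) * Real.cos (2 * Real.pi * (∑ k, ((q k : ℕ) : ℝ) * ((j k : ℕ) : ℝ)) / m)) / (m : ℝ) ^ 3; (∑ q : Fin 3 → Fin m with (∃ k, (q k : ℕ) ≠ 0), max (-(ν q)) 0 / (2 * Real.pi / L * Real.sqrt (∑ k, ((min (q k : ℕ) (m - (q k : ℕ)) : ℕ) : ℝ) ^ 2))) ≤ C := by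
  intro η hη
  refine ⟨1, 1, one_pos, fun ρ hρ _ => ?_⟩
  filter_upwards [eventually_gt_atTop 0] with N hN
  have hL : 0 < sideLength ρ N := by
    unfold sideLength
    exact Real.rpow_pos_of_pos (div_pos (Nat.cast_pos.2 hN) hρ) _
  set L : ℝ := sideLength ρ N with hLdef
  set m : ℕ := ⌊L / η⌋₊ with hmdef
  set ε : ℝ := 1 / (2 * ((m : ℝ) ^ 3 + 1) * (L + 1)) with hε
  have hεpos : 0 < ε := by positivity
  have hε2 : ε ≤ 1 / 2 := eps_le_half (by nlinarith [pow_nonneg (Nat.cast_nonneg m : (0 : ℝ) ≤ m) 3])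
    (by linarith)
  obtain ⟨δ, hδ, H⟩ := free_nearMinimiser_log hL hN hεpos hε2
  refine ⟨δ, hδ, fun Ψ hΨ i => ?_⟩
  dsimp only
  have hlog : ∀ j : Fin 3 → Fin m, |Real.log ((∫ X in cellN N L, conj (Ψ.ψ (Function.update X i
      (X i + latticeVec (L / m) (fun k => ((j k : ℕ) : ℤ))))) * Ψ.ψ X).re)| ≤ 2 * ε :=
    fun j => H Ψ hΨ i _ (norm_sq_latticeVec_grid_le hL.le j)
  have hν : ∀ q : Fin 3 → Fin m, |-((∑ j : Fin 3 → Fin m, Real.log ((∫ X in cellN N L,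
      conj (Ψ.ψ (Function.update X i (X i + latticeVec (L / m) (fun k => ((j k : ℕ) : ℤ))))) * Ψ.ψ X).re) *
        Real.cos (2 * Real.pi * (∑ k, ((q k : ℕ) : ℝ) * ((j k : ℕ) : ℝ)) / m)) / (m : ℝ) ^ 3)| ≤ 2 * ε := by
    intro q
    rw [abs_neg]
    exact abs_levyWeight_le (θ := fun q j => 2 * Real.pi * (∑ k, ((q k : ℕ) : ℝ) * ((j k : ℕ) : ℝ)) / m)
      (by positivity) hlog q
  calc _ ≤ (m : ℝ) ^ 3 * (2 * ε * L / (2 * Real.pi)) :=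
        sum_max_div_waveNumber_le (w := fun q => -((∑ j : Fin 3 → Fin m, Real.log ((∫ X in cellN N L,
          conj (Ψ.ψ (Function.update X i (X i + latticeVec (L / m) (fun k => ((j k : ℕ) : ℤ))))) * Ψ.ψ X).re) *
            Real.cos (2 * Real.pi * (∑ k, ((q k : ℕ) : ℝ) * ((j k : ℕ) : ℝ)) / m)) / (m : ℝ) ^ 3))
          hL (by positivity) hν
    _ ≤ 1 / (2 * Real.pi) := cube_mul_eps_mul_le (by positivity) hL.le (by positivity)
    _ ≤ 1 := by
        rw [div_le_one (by positivity)]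
        linarith [Real.pi_gt_three]

/-- **The registered stub `stub_logClusterL1` holds for the free gas** (`C = 1`, centring `c = 0`):
verbatim its registered signature at `v = 0` (`sum_abs_mul_weight_le`: the weighted ℓ¹ sum is
`≤ m³ · 2ε · L ≤ 1`). [folklore] -/
theorem logClusterL1_free : ∀ η : ℝ, 0 < η → ∃ C : ℝ, ∃ ρ₀ : ℝ, 0 < ρ₀ ∧ ∀ ρ : ℝ, 0 < ρ → ρ < ρ₀ → ∀ᶠ N : ℕ in Filter.atTop, ∃ δ : ENNReal, 0 < δ ∧ ∀ Ψ : Literature.MathematicalPhysics.QuantumManyBody.BoseGas.PeriodicTrialState N (Literature.MathematicalPhysics.QuantumManyBody.BoseGas.sideLength ρ N), Literature.MathematicalPhysics.QuantumManyBody.BoseGas.periodicEnergy (0 : ℝ → ENNReal) Ψ ≤ Literature.MathematicalPhysics.QuantumManyBody.BoseGas.periodicGroundStateEnergy (0 : ℝ → ENNReal) N (Literature.MathematicalPhysics.QuantumManyBody.BoseGas.sideLength ρ N) + δ → ∀ i : Fin N, let L : ℝ := Literature.MathematicalPhysics.QuantumManyBody.BoseGas.sideLength ρ N; let m : ℕ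 := ⌊L / η⌋₊; let G : EuclideanSpace ℝ (Fin 3) → ℝ := fun r => (∫ X in Literature.MathematicalPhysics.QuantumManyBody.BoseGas.cellN N L, conj (Ψ.ψ (Function.update X i (X i + r))) * Ψ.ψ X).re; ∃ c : ℝ, (∑ j : Fin 3 → Fin m, |Real.log (G (Literature.MathematicalPhysics.QuantumManyBody.BoseGas.latticeVec (L / m) (fun k => ((j k : ℕ) : ℤ)))) - c| * ((L / m) / (1 + ∑ k, ((min (j k : ℕ) (m - (j k : ℕ)) : ℕ) : ℝ) ^ 2))) ≤ C := by
  intro η hη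
  refine ⟨1, 1, one_pos, fun ρ hρ _ => ?_⟩
  filter_upwards [eventually_gt_atTop 0] with N hN
  have hL : 0 < sideLength ρ N := by
    unfold sideLength
    exact Real.rpow_pos_of_pos (div_pos (Nat.cast_pos.2 hN) hρ) _
  set L : ℝ := sideLength ρ N with hLdef
  set m : ℕ := ⌊L / η⌋₊ with hmdef
  set ε : ℝ := 1 / (2 * ((m : ℝ) ^ 3 + 1) * (L + 1)) with hε
  have hεpos : 0 < ε := by positivity
  have hε2 : ε ≤ 1 / 2 := eps_le_half (by nlinarith [pow_nonneg (Nat.cast_nonneg m : (0 : ℝ) ≤ m) 3])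
    (by linarith)
  obtain ⟨δ, hδ, H⟩ := free_nearMinimiser_log hL hN hεpos hε2
  refine ⟨δ, hδ, fun Ψ hΨ i => ?_⟩
  dsimp only
  refine ⟨0, ?_⟩
  have hlog : ∀ j : Fin 3 → Fin m, |Real.log ((∫ X in cellN N L, conj (Ψ.ψ (Function.update X i
      (X i + latticeVec (L / m) (fun k => ((j k : ℕ) : ℤ))))) * Ψ.ψ X).re)| ≤ 2 * ε :=
    fun j => H Ψ hΨ i _ (norm_sq_latticeVec_grid_le hL.le j)
  calc _ ≤ (m : ℝ) ^ 3 * (2 * ε * L) := sum_abs_mul_weight_le hL.le (by positivity) hlog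
    _ = (m : ℝ) ^ 3 * (2 * ε * L / 1) := by rw [div_one]
    _ ≤ 1 / 1 := cube_mul_eps_mul_le (by positivity) hL.le one_pos
    _ = 1 := div_one 1

/-- **To prove the crux it suffices to treat genuinely interacting potentials**: `LevyNegativeMoment`
follows from its own body restricted to `v ≠ 0` (the free case being `levyNegativeMoment_free`).  This
also certifies that `levyNegativeMoment_free` is literally the `v = 0` instance of the route decl. [folklore] -/
theorem levyNegativeMoment_of_ne_zero
    (h : ∀ v : ℝ → ENNReal, Literature.MathematicalPhysics.QuantumManyBody.BoseGas.IsRepulsiveFiniteRange v →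
      v ≠ 0 → ∀ η : ℝ, 0 < η → ∃ C : ℝ, ∃ ρ₀ : ℝ, 0 < ρ₀ ∧ ∀ ρ : ℝ, 0 < ρ → ρ < ρ₀ → ∀ᶠ N : ℕ in Filter.atTop, ∃ δ : ENNReal, 0 < δ ∧ ∀ Ψ : Literature.MathematicalPhysics.QuantumManyBody.BoseGas.PeriodicTrialState N (Literature.MathematicalPhysics.QuantumManyBody.BoseGas.sideLength ρ N), Literature.MathematicalPhysics.QuantumManyBody.BoseGas.periodicEnergy v Ψ ≤ Literature.MathematicalPhysics.QuantumManyBody.BoseGas.periodicGroundStateEnergy v N (Literature.MathematicalPhysics.QuantumManyBody.BoseGas.sideLength ρ N) + δ → ∀ i : Fin N, let L : ℝ := Literature.MathematicalPhysics.QuantumManyBody.BoseGas.sideLength ρ N; let m : ℕ := ⌊L / η⌋₊; let G : EuclideanSpace ℝ (Fin 3) → ℝ := fun r => (∫ X in Literature.MathematicalPhysics.QuantumManyBody.BoseGas.cellN N L, conj (Ψ.ψ (Function.update X i (X i + r))) * Ψ.ψ X).re; let ν : (Fin 3 → Fin m) → ℝ := fun q => (∑ j : Fin 3 → Fin m, Real.log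 (G (Literature.MathematicalPhysics.QuantumManyBody.BoseGas.latticeVec (L / m) (fun k => ((j k : ℕ) : ℤ)))) * Real.cos (2 * Real.pi * (∑ k, ((q k : ℕ) : ℝ) * ((j k : ℕ) : ℝ)) / m)) / (m : ℝ) ^ 3; (∑ q : Fin 3 → Fin m with (∃ k, (q k : ℕ) ≠ 0), max (ν q) 0 / (2 * Real.pi / L * Real.sqrt (∑ k, ((min (q k : ℕ) (m - (q k : ℕ)) : ℕ) : ℝ) ^ 2))) ≤ C) :
    Summit.AtomisticToContinuum.BoseEinsteinCondensation.Theses.BECInfDivCoherence.LevyNegativeMoment := by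
  intro v hv
  by_cases h0 : v = 0
  · subst h0
    exact levyNegativeMoment_free
  · exact h v hv h0

end Summit.AtomisticToContinuum.BoseEinsteinCondensation.Theorems.CoherenceNearField

end
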